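import Summits.BirchSwinnertonDyer.BirchSwinnertonDyer.Theorems.AlignedTransportAtTwoMainConjectureOfRankZeroBSDAtTwoFineRoad
import HarnessLib

/-!
# Route `AlignedTransportAtTwo`, crux C2 `MainConjectureOfRankZeroBSDAtTwo` (stmt-BirchSwinnertonDyer-22298):
# the fine road run over `K = ℚ(i)` — TWO-BRANCH `μ`-bookkeeping over `Λ_G = Λ₀[Δ]` (`Δ = {±1}`, no
# idempotents at `2`) and the descent to `ℚ_∞` (road (b′): no construction target at `(2)`)

HONEST FRAMING (cell `bsd-f1-sign2`, lead prover seat `bsd-line-att-p2` gen 2; BSD is NOT proved by any of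
this). THEOREMS ONLY, pure commutative algebra plus one per-datum reading; nothing about elliptic curves is
asserted. Sibling of `…FineRoad` (road (b) over `ℚ_∞`, whose stub K₂ — Kato's §17.13 data at good ordinary `2`
WITH NO `2`-POWER DEFECT — is a construction target, not in print). ROAD (b′) removes that target: over
`K = ℚ(i) = ℚ(ζ₄)` the cyclotomic `ℤ₂`-tower IS Kato's `ℚ(ζ_{2^∞})`, `Λ(Γ_K) = Λ₀ = ℤ₂⟦T⟧` is regular, there is
NO `Δ`-descent and NO archimedean place (cf. the tree's `Kato2004.charIdeal_dvd_padicLFunction_cyclotomicFour_two`),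
and Kato's Prop. 17.11 / Thm. 12.6 / Thm. 16.6 are parity-free in print. The price: the Coleman map takes
values in `Λ_G = ℤ₂[[G_∞]] = Λ₀[c]/(c² − 1)`, which at `2` is NOT `Λ₀ × Λ₀` (12.1: «the cokernel is killed by
`2`»), so BOTH branches of the `2`-adic `L`-function enter — and they enter through a DETERMINANT, not through
idempotents:

* §1 `lengthAt_le_of_fineSkeleton_map`: the fine bookkeeping with a Coleman map to ANY module `F` and ANY zeta
  submodule `Z`: `ℓ_𝔭(X) ≤ ℓ_𝔭(ker col) + ℓ_𝔭(F/col(loc Z)) + ℓ_𝔭(Y)`; `lengthAt_le_of_lengthAt_coker_eq_zero`: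
  the descent step (a map with cokernel of length `0` does not decrease length).
* §2 `lengthAt_quotient_span_circulant`: for `a ≠ b` in a domain, `ℓ_𝔭(R²/⟨(a,b),(b,a)⟩) =
  ℓ_𝔭(R/(a+b)) + ℓ_𝔭(R/(a−b))` at EVERY prime — the `Λ₀`-length of `Λ_G/(a + bc)Λ_G` is the sum over the two
  characters `χ_±(a + bc) = a ± b` of `Δ`, although `Λ_G` does not split (filtration by the diagonal).
* §3 `lengthAt_le_of_twoBranchSkeleton`, `lengthAt_augIdealP_eq_zero_of_twoBranchSkeleton`:
  `μ(X') ≤ μ(ker col) + μ(a+b) + μ(a−b) + μ(Y')`; and the per-datum statement at `2`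
  `selmerDual_mu_eq_zero_of_twoBranchSkeleton_two`: DISPLAYED Kato data over `ℚ(ζ_{2^∞})` (row
  `𝐇¹ → P → X(E/K_∞) → X₀(E/K_∞)`, injective `col : P → Λ_G`, integral classes `z_{c,d}`, `c·z_{c,d}` with
  `𝔏(z_{c,d}) = a + bc = μ_{c,d}·L_{2-adic}(f)`), BOTH `a ± b ∉ (2)` (even branch `ϖ·μ⁺_{c,d}·L₂(E,T)` and odd
  branch `μ⁻_{c,d}·L₂(E,χ₋₄,T)` have `μ = 0`; for `c ≡ 5 mod 8` the Kato factors `μ^±_{c,d}` have unit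
  `T`-coefficient), statement (A) for `E/ℚ(i)` at `2`, and a descent map `X(E/K_∞) → X(E/ℚ_∞)` with finite
  cokernel (`H¹(Δ, E(K_∞)[2^∞])`) ⟹ `μ(X(E/ℚ_∞)) = 0`.

WHAT REMAINS OUTSIDE THE KERNEL on road (b′) (for the typer / referees, not asserted here): (α) exactness of
(14.9.3)/(17.13.1) over the totally imaginary tower at `p = 2` (Kato: «exact upto ×2 in the case p = 2» —
to be audited: the `×2` is the real-place étale/Galois discrepancy, absent for `ℚ(ζ_{2^n})`, `n ≥ 2`?);
(β) 17.11, 12.6, 16.6 at `2` as named facts over `ℚ(i)`; (γ) Lim 2017 Thm. 3.5 for the base field `ℚ(i)`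
(`L = ℚ(i, e₁)`) and Iwasawa 1973 (`μ = 0` ascends the `2`-extension `ℚ(i,e₁)/ℚ(e₁)`), reducing statement (A)
over `ℚ(i)` to the classical `μ = 0` of the cubic field `ℚ(e₁)` (stub A₂); (δ) the odd-branch analytic
input `μ(L₂(E, χ₋₄, T)) = 0` per seed (finite computation).

References: K. Kato, Astérisque 295 (2004), §12.1, Thm. 12.6, (14.9.3), Thm. 16.6, Prop. 17.11, §17.13;
J. Coates, R. Sujatha, Math. Ann. 331 (2005) §3; L. Washington, GTM 83, §13.2.
-/

set_option linter.dupNamespace false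
set_option autoImplicit false

noncomputable section

open scoped Classical

open Literature.NumberTheory.EllipticCurves Literature.NumberTheory.EllipticCurves.Module

namespace Summit.BirchSwinnertonDyer.BirchSwinnertonDyer.Theorems.AlignedTransportAtTwoFineRoad

/-! ## §1 The fine bookkeeping with a Coleman map to ANY module and ANY zeta submodule -/

section General

variable {R : Type*} [CommRing R]
  {H P X Y F : Type*} [AddCommGroup H] [_root_.Module R H] [AddCommGroup P] [_root_.Module R P]
  [AddCommGroup X] [_root_.Module R X] [AddCommGroup Y] [_root_.Module R Y]
  [AddCommGroup F] [_root_.Module R F]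

/-- **Fine bookkeeping, general target.** `loc : H → P`, `toX : P → X`, `π : X → Y` with `toX ∘ loc = 0`
and `P → X → Y` exact at `X`; `col : P → F` ANY linear map (Coleman map with values in `Λ_G`, say) and
`Z ≤ H` ANY submodule (the zeta module). Then at every prime
`ℓ_𝔭(X) ≤ ℓ_𝔭(ker col) + ℓ_𝔭(F ⧸ col(loc Z)) + ℓ_𝔭(Y)`. [cite: Kato2004Asterisque, §17.13 (pp. 279–280)] -/
theorem lengthAt_le_of_fineSkeleton_map (loc : H →ₗ[R] P) (toX : P →ₗ[R] X) (π : X →ₗ[R] Y)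
    (col : P →ₗ[R] F) (h0 : ∀ h, toX (loc h) = 0) (hX : Function.Exact toX π)
    (Z : Submodule R H) (𝔭 : PrimeSpectrum R) :
    lengthAt R X 𝔭 ≤ lengthAt R (LinearMap.ker col) 𝔭 +
      lengthAt R (F ⧸ Submodule.map col (Submodule.map loc Z)) 𝔭 + lengthAt R Y 𝔭 := by
  set LZ : Submodule R P := Submodule.map loc Z with hLZ
  set M : Submodule R F := Submodule.map col LZ with hM
  have hLZM : ∀ y ∈ LZ, col y ∈ M := fun y hy => Submodule.mem_map_of_mem hy
  let q : (P ⧸ LZ) →ₗ[R] (F ⧸ M) := Submodule.mapQ LZ M col hLZM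
  let j : LinearMap.ker col →ₗ[R] (P ⧸ LZ) := LZ.mkQ ∘ₗ (LinearMap.ker col).subtype
  have hjq : Function.Exact j q := by
    rw [LinearMap.exact_iff]
    change LinearMap.ker (Submodule.mapQ LZ M col hLZM) = LinearMap.range (LZ.mkQ ∘ₗ _)
    rw [Submodule.ker_mapQ, hM, Submodule.comap_map_eq, Submodule.map_sup,
      Submodule.mkQ_map_self, bot_sup_eq, LinearMap.range_comp, Submodule.range_subtype]
  have h1 : lengthAt R (P ⧸ LZ) 𝔭 ≤ lengthAt R (LinearMap.ker col) 𝔭 + lengthAt R (F ⧸ M) 𝔭 :=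
    lengthAt_le_add_of_exact j q hjq 𝔭
  have hle : LZ ≤ LinearMap.ker toX := by
    rintro _ ⟨z, -, rfl⟩
    exact h0 z
  let f' : (P ⧸ LZ) →ₗ[R] X := LZ.liftQ toX hle
  have hf' : Function.Exact f' π := by
    rw [LinearMap.exact_iff, Submodule.range_liftQ]
    exact LinearMap.exact_iff.mp hX
  have h2 : lengthAt R X 𝔭 ≤ lengthAt R (P ⧸ LZ) 𝔭 + lengthAt R Y 𝔭 :=
    lengthAt_le_add_of_exact f' π hf' 𝔭
  calc lengthAt R X 𝔭 ≤ lengthAt R (P ⧸ LZ) 𝔭 + lengthAt R Y 𝔭 := h2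
    _ ≤ (lengthAt R (LinearMap.ker col) 𝔭 + lengthAt R (F ⧸ M) 𝔭) + lengthAt R Y 𝔭 := by gcongr

/-- **Descent step (finite cokernel).** If `f : X' → X` has a cokernel of `𝔭`-length `0` (e.g. FINITE,
at `𝔭 = (p)`), then `ℓ_𝔭(X) ≤ ℓ_𝔭(X')` — the shape of the restriction `X(E/K_∞) → X(E/ℚ_∞)` for
`K_∞ = ℚ_∞(i)`, whose cokernel is dual to `H¹(Δ, E(K_∞)[2^∞])`. [folklore] -/
theorem lengthAt_le_of_lengthAt_coker_eq_zero {X' : Type*} [AddCommGroup X'] [_root_.Module R X']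
    (f : X' →ₗ[R] X) (𝔭 : PrimeSpectrum R) (hc : lengthAt R (X ⧸ LinearMap.range f) 𝔭 = 0) :
    lengthAt R X 𝔭 ≤ lengthAt R X' 𝔭 := by
  rw [lengthAt_eq_add_quotient (LinearMap.range f) 𝔭, hc, add_zero]
  exact lengthAt_le_of_surjective f.rangeRestrict f.surjective_rangeRestrict 𝔭

end General

/-! ## §2 The circulant: `ℓ_𝔭(R² ⧸ ⟨(a,b),(b,a)⟩) = ℓ_𝔭(R/(a+b)) + ℓ_𝔭(R/(a−b))` over any domain -/

section Circulant

variable {R : Type*} [CommRing R] [IsDomain R]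

/-- The diagonal of `R × R` meets the circulant span `⟨(a,b),(b,a)⟩` in `(a+b)·(1,1)` (`a ≠ b`). [folklore] -/
theorem mem_span_circulant_diag_iff {a b : R} (hab : a ≠ b) (x : R) :
    ((x, x) : R × R) ∈ Submodule.span R ({(a, b), (b, a)} : Set (R × R)) ↔ a + b ∣ x := by
  constructor
  · intro hx
    rw [Submodule.mem_span_pair] at hx
    obtain ⟨u, v, huv⟩ := hx
    have h1 : u * a + v * b = x := by simpa using congrArg Prod.fst huv
    have h2 : u * b + v * a = x := by simpa using congrArg Prod.snd huv
    have huv' : (u - v) * (a - b) = 0 := by linear_combination h1 - h2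
    rcases mul_eq_zero.mp huv' with h | h
    · have hu : u = v := sub_eq_zero.mp h
      exact ⟨u, by rw [← h1, hu]; ring⟩
    · exact absurd (sub_eq_zero.mp h) hab
  · rintro ⟨r, rfl⟩
    rw [Submodule.mem_span_pair]
    exact ⟨r, r, by ext <;> simp <;> ring⟩

/-- **Length of the circulant quotient.** For `a ≠ b` in a domain `R` and every prime `𝔭`:
`ℓ_𝔭(R × R ⧸ ⟨(a,b),(b,a)⟩) = ℓ_𝔭(R/(a+b)) + ℓ_𝔭(R/(a−b))` — filtration by the diagonal `D`:
`R²/(N+D) ≅ R/(a−b)` via `(x,y) ↦ x − y`, and `(N+D)/N ≅ D/(D ∩ N) ≅ R/(a+b)`. This is the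
`Λ₀`-length of `Λ_G/(a + b·c)Λ_G` for the group ring `Λ_G = Λ₀[c]/(c² − 1)` of `Δ = {±1}` at `p = 2`
(Kato's `ℤ₂[[G_∞]]`, §12.1), where `a ± b` are the two branch components. [cite: Kato2004Asterisque, §12.1 (pp. 219–220)] -/
theorem lengthAt_quotient_span_circulant {a b : R} (hab : a ≠ b) (𝔭 : PrimeSpectrum R) :
    lengthAt R ((R × R) ⧸ Submodule.span R ({(a, b), (b, a)} : Set (R × R))) 𝔭 =
      lengthAt R (R ⧸ Ideal.span {a + b}) 𝔭 + lengthAt R (R ⧸ Ideal.span {a - b}) 𝔭 := by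
  set N : Submodule R (R × R) := Submodule.span R ({(a, b), (b, a)} : Set (R × R)) with hN
  -- the diagonal embedding and the difference functional
  let diag : R →ₗ[R] R × R := LinearMap.prod LinearMap.id LinearMap.id
  let δ : R × R →ₗ[R] R := LinearMap.fst R R R - LinearMap.snd R R R
  set D : Submodule R (R × R) := LinearMap.range diag with hD
  -- (1) `R²/(N ⊔ D) ≅ R/(a-b)` via `δ`
  have hker : LinearMap.ker ((Ideal.span {a - b}).mkQ ∘ₗ δ) = N ⊔ D := by
    apply le_antisymm
    · intro v hv
      rw [LinearMap.mem_ker, LinearMap.comp_apply, Submodule.mkQ_apply,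
        Submodule.Quotient.mk_eq_zero, Ideal.mem_span_singleton] at hv
      obtain ⟨r, hr⟩ := hv
      -- `v = r·(a,b) + (diagonal)`: indeed `v - r·(a,b)` has `δ = 0`
      have hδ : v.1 - v.2 = (a - b) * r := hr
      have hmem : v - r • ((a, b) : R × R) ∈ D := by
        refine ⟨v.1 - r * a, ?_⟩
        change ((v.1 - r * a, v.1 - r * a) : R × R) = v - r • ((a, b) : R × R)
        ext
        · simp
        · simp only [Prod.snd_sub, Prod.smul_snd, smul_eq_mul]
          linear_combination hδ
      have hn : r • ((a, b) : R × R) ∈ N := N.smul_mem r (Submodule.subset_span (by simp))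
      have : v = r • ((a, b) : R × R) + (v - r • (a, b)) := by abel
      rw [this]
      exact Submodule.add_mem_sup hn hmem
    · refine sup_le ?_ ?_
      · rw [hN, Submodule.span_le]
        rintro v hv
        simp only [Set.mem_insert_iff, Set.mem_singleton_iff] at hv
        rw [SetLike.mem_coe, LinearMap.mem_ker, LinearMap.comp_apply, Submodule.mkQ_apply,
          Submodule.Quotient.mk_eq_zero, Ideal.mem_span_singleton]
        rcases hv with rfl | rfl
        · exact ⟨1, by change a - b = (a - b) * 1; ring⟩
        · exact ⟨-1, by change b - a = (a - b) * (-1); ring⟩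
      · rintro _ ⟨x, rfl⟩
        rw [LinearMap.mem_ker, LinearMap.comp_apply, Submodule.mkQ_apply,
          Submodule.Quotient.mk_eq_zero]
        simp [δ, diag]
  have hsurj : Function.Surjective ((Ideal.span {a - b}).mkQ ∘ₗ δ) := by
    intro q
    obtain ⟨x, rfl⟩ := Submodule.mkQ_surjective _ q
    exact ⟨(x, 0), by simp [δ]⟩
  have e1 : ((R × R) ⧸ (N ⊔ D)) ≃ₗ[R] (R ⧸ Ideal.span {a - b}) :=
    (Submodule.quotEquivOfEq _ _ hker.symm).trans (LinearMap.quotKerEquivOfSurjective _ hsurj)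
  -- (2) `(N ⊔ D)/N ≅ D/(D ⊓ N) ≅ R/(a+b)`
  let g : R →ₗ[R] ((R × R) ⧸ N) := N.mkQ ∘ₗ diag
  have hkerg : LinearMap.ker g = Ideal.span {a + b} := by
    ext x
    rw [LinearMap.mem_ker, LinearMap.comp_apply, Submodule.mkQ_apply, Submodule.Quotient.mk_eq_zero,
      Ideal.mem_span_singleton]
    exact mem_span_circulant_diag_iff hab x
  have hrange : LinearMap.range g = (N ⊔ D).map N.mkQ := by
    rw [LinearMap.range_comp, ← hD, Submodule.map_sup, Submodule.mkQ_map_self, bot_sup_eq]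
  have e2 : (R ⧸ Ideal.span {a + b}) ≃ₗ[R] (N ⊔ D).map N.mkQ :=
    (Submodule.quotEquivOfEq _ _ hkerg.symm).trans (g.quotKerEquivRange.trans
      (LinearEquiv.ofEq _ _ hrange))
  -- (3) assemble
  rw [lengthAt_eq_add_quotient ((N ⊔ D).map N.mkQ) 𝔭, ← lengthAt_eq_of_linearEquiv e2 𝔭,
    lengthAt_eq_of_linearEquiv (Submodule.quotientQuotientEquivQuotient N (N ⊔ D) le_sup_left) 𝔭,
    lengthAt_eq_of_linearEquiv e1 𝔭]

end Circulant

/-! ## §3 The two-branch bookkeeping and its `μ`-reading at `(p)`; the per-datum statement at `2` over `ℚ(i)` -/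

section TwoBranch

variable {R : Type*} [CommRing R] [IsDomain R]
  {H P X Y : Type*} [AddCommGroup H] [_root_.Module R H] [AddCommGroup P] [_root_.Module R P]
  [AddCommGroup X] [_root_.Module R X] [AddCommGroup Y] [_root_.Module R Y]

/-- **Two-branch fine bookkeeping.** Same row `H → P → X → Y` as before, but the Coleman map takes values in
the free rank-two module `R × R` (`= Λ_G = Λ₀ ⊕ Λ₀·c` over `Λ₀`) and the zeta module is spanned by two
classes `z₁, z₂` (`z₂ = c·z₁`) with `col (loc z₁) = (a, b)`, `col (loc z₂) = (b, a)` (multiplication by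
`G = a + b·c` on the basis `{1, c}`), `a ≠ b`. Then
`ℓ_𝔭(X) ≤ ℓ_𝔭(ker col) + ℓ_𝔭(R/(a+b)) + ℓ_𝔭(R/(a−b)) + ℓ_𝔭(Y)` — the two BRANCHES `a ± b = χ_±(G)` enter
separately although `Λ_G` has no idempotents when `2 ∉ Rˣ`. [cite: Kato2004Asterisque, §12.1 (pp. 219–220) and §17.13 (pp. 279–280)] -/
theorem lengthAt_le_of_twoBranchSkeleton (loc : H →ₗ[R] P) (toX : P →ₗ[R] X) (π : X →ₗ[R] Y)
    (col : P →ₗ[R] R × R) (h0 : ∀ h, toX (loc h) = 0) (hX : Function.Exact toX π)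
    {z₁ z₂ : H} {a b : R} (hab : a ≠ b) (hz₁ : col (loc z₁) = (a, b)) (hz₂ : col (loc z₂) = (b, a))
    (𝔭 : PrimeSpectrum R) :
    lengthAt R X 𝔭 ≤ lengthAt R (LinearMap.ker col) 𝔭 + lengthAt R (R ⧸ Ideal.span {a + b}) 𝔭 +
      lengthAt R (R ⧸ Ideal.span {a - b}) 𝔭 + lengthAt R Y 𝔭 := by
  have h := lengthAt_le_of_fineSkeleton_map loc toX π col h0 hX (Submodule.span R {z₁, z₂}) 𝔭
  have hmap : Submodule.map col (Submodule.map loc (Submodule.span R {z₁, z₂})) =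
      Submodule.span R ({(a, b), (b, a)} : Set (R × R)) := by
    rw [Submodule.map_span, Submodule.map_span, Set.image_pair, Set.image_pair, hz₁, hz₂]
  rw [hmap, lengthAt_quotient_span_circulant hab 𝔭, ← add_assoc] at h
  exact h

end TwoBranch

section AtP

variable (p : ℕ) [Fact p.Prime]
  {H P X Y : Type*} [AddCommGroup H] [_root_.Module (IwasawaAlgebra p) H]
  [AddCommGroup P] [_root_.Module (IwasawaAlgebra p) P]
  [AddCommGroup X] [_root_.Module (IwasawaAlgebra p) X]
  [AddCommGroup Y] [_root_.Module (IwasawaAlgebra p) Y]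

/-- A FINITE `Λ`-module has `(p)`-length `0` (it is finitely generated over `ℤ_p`; Washington §13.2).
Used for the cokernel of the descent map, dual to `H¹(Δ, E(K_∞)[p^∞])`. [cite: Washington1997, §13.2] -/
theorem lengthAt_augIdealP_eq_zero_of_finite (C : Type*) [AddCommGroup C]
    [_root_.Module (IwasawaAlgebra p) C] [Finite C] (𝔭 : PrimeSpectrum (IwasawaAlgebra p))
    (h𝔭 : 𝔭.asIdeal = IwasawaAlgebra.augIdealP p) : lengthAt (IwasawaAlgebra p) C 𝔭 = 0 := by
  letI : _root_.Module ℤ_[p] C := _root_.Module.compHom C (algebraMap ℤ_[p] (IwasawaAlgebra p))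
  haveI : IsScalarTower ℤ_[p] (IwasawaAlgebra p) C := IsScalarTower.of_compHom ℤ_[p] _ C
  haveI : _root_.Module.Finite ℤ_[p] C := Module.Finite.of_finite
  exact lengthAt_eq_zero_of_finite p C 𝔭 h𝔭

/-- **`μ = 0` on the two-branch road.** Over `Λ₀ = ℤ_p⟦T⟧` at `𝔭 = (p)`: an injective Coleman map, both
branch values `a + b`, `a − b` outside `(p)` (`μ` of BOTH branches of the zeta image vanishes) and
`ℓ_{(p)}(Y) = 0` (statement (A) over the larger field) give `ℓ_{(p)}(X) = 0`.
[cite: Kato2004Asterisque, §17.13 (pp. 279–280)] [cite: CoatesSujatha2005, statement (A) (§3)] -/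
theorem lengthAt_augIdealP_eq_zero_of_twoBranchSkeleton (loc : H →ₗ[IwasawaAlgebra p] P)
    (toX : P →ₗ[IwasawaAlgebra p] X) (π : X →ₗ[IwasawaAlgebra p] Y)
    (col : P →ₗ[IwasawaAlgebra p] IwasawaAlgebra p × IwasawaAlgebra p)
    (hcol : Function.Injective col) (h0 : ∀ h, toX (loc h) = 0) (hX : Function.Exact toX π)
    {z₁ z₂ : H} {a b : IwasawaAlgebra p} (hz₁ : col (loc z₁) = (a, b)) (hz₂ : col (loc z₂) = (b, a))
    (ha : a + b ∉ IwasawaAlgebra.augIdealP p) (hb : a - b ∉ IwasawaAlgebra.augIdealP p)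
    (𝔭 : PrimeSpectrum (IwasawaAlgebra p)) (h𝔭 : 𝔭.asIdeal = IwasawaAlgebra.augIdealP p)
    (hY : lengthAt (IwasawaAlgebra p) Y 𝔭 = 0) : lengthAt (IwasawaAlgebra p) X 𝔭 = 0 := by
  have hab : a ≠ b := by
    rintro rfl
    exact hb (by rw [sub_self]; exact Submodule.zero_mem _)
  have hk : LinearMap.ker col = ⊥ := LinearMap.ker_eq_bot.mpr hcol
  have hker : lengthAt (IwasawaAlgebra p) (LinearMap.ker col) 𝔭 = 0 := by
    rw [hk]; exact lengthAt_eq_zero_of_subsingleton 𝔭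
  have hqa : lengthAt (IwasawaAlgebra p) (IwasawaAlgebra p ⧸ Ideal.span {a + b}) 𝔭 = 0 :=
    lengthAt_quotient_eq_zero_of_not_le (by rwa [Ideal.span_singleton_le_iff_mem, h𝔭])
  have hqb : lengthAt (IwasawaAlgebra p) (IwasawaAlgebra p ⧸ Ideal.span {a - b}) 𝔭 = 0 :=
    lengthAt_quotient_eq_zero_of_not_le (by rwa [Ideal.span_singleton_le_iff_mem, h𝔭])
  have h := lengthAt_le_of_twoBranchSkeleton loc toX π col h0 hX hab hz₁ hz₂ 𝔭
  rw [hker, hqa, hqb, hY] at h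
  simpa using h

end AtP

section AtTwoOverQi

open WeierstrassCurve

variable (W : WeierstrassCurve ℚ) {κ : ZpExtension ℚ 2} {γ : Field.absoluteGaloisGroup ℚ}

/-- **ROAD (b′), per cyclotomic datum: the fine road run over `K = ℚ(i)` and descended to `ℚ_∞`.**
Let `X = X(E/ℚ_∞)` (`D`, the tree's strict dual Selmer datum at `2`). DISPLAYED data (all abstract
`Λ₀ = ℤ₂⟦T⟧`-modules and maps; `Λ₀ = Λ(Γ_K)` for `K = ℚ(i)`, whose cyclotomic `ℤ₂`-tower is Kato's
`ℚ(ζ_{2^∞})`, so NO `Δ`-descent and NO archimedean place intervene upstairs): `X'` (`= X(E/K_∞)`), `Y'`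
(`= X₀(E/K_∞)`), the Poitou–Tate row `H → P → X' → Y'` ((14.9.3)/(17.13.1) over the totally imaginary
tower), an INJECTIVE Coleman map `col : P → Λ₀ × Λ₀` (`= Λ_G`; Prop. 17.11), two integral zeta classes
`z₁, z₂ = c·z₁` (Thm. 12.6) with `col (loc z₁) = (a, b)`, `col (loc z₂) = (b, a)` (Thm. 16.6:
`a + b·c = 𝔏(z_{c,d}) = μ_{c,d}·L_{2-adic}(f)`), BOTH branch values `a ± b` outside `(2)` (= `μ` of the
even branch `μ_{c,d}⁺·ϖ·L₂(E,T)` AND of the odd branch `μ_{c,d}⁻·L₂(E,χ₋₄,T)` vanish), statement (A)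
for `E` over `K` (`ℓ_{(2)}(Y') = 0`), and a descent map `f : X' → X` with FINITE cokernel (dual to the
restriction `Sel(E/ℚ_∞) → Sel(E/K_∞)`, kernel `H¹(Δ, E(K_∞)[2^∞])`). THEN `μ(X(E/ℚ_∞)) = 0`. Every input
except the two analytic `μ`'s and statement (A) over `K` is a printed statement at `p = 2` awaiting
typing/audit (the `×2` caveat of (17.13.1)); nothing is asserted here.
[cite: Kato2004Asterisque, §12.1, Thm. 12.6 (p. 222), Thm. 16.6 (p. 271), Prop. 17.11 (p. 277), §17.13 (pp. 279–280)]
[cite: CoatesSujatha2005, statement (A) (§3)] -/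
theorem selmerDual_mu_eq_zero_of_twoBranchSkeleton_two (D : W.SelmerDualData κ γ)
    {H P X' Y' : Type*} [AddCommGroup H] [_root_.Module (IwasawaAlgebra 2) H]
    [AddCommGroup P] [_root_.Module (IwasawaAlgebra 2) P]
    [AddCommGroup X'] [_root_.Module (IwasawaAlgebra 2) X']
    [AddCommGroup Y'] [_root_.Module (IwasawaAlgebra 2) Y']
    (loc : H →ₗ[IwasawaAlgebra 2] P) (toX : P →ₗ[IwasawaAlgebra 2] X')
    (π : X' →ₗ[IwasawaAlgebra 2] Y') (col : P →ₗ[IwasawaAlgebra 2] IwasawaAlgebra 2 × IwasawaAlgebra 2)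
    (hcol : Function.Injective col) (h0 : ∀ h, toX (loc h) = 0) (hX : Function.Exact toX π)
    {z₁ z₂ : H} {a b : IwasawaAlgebra 2} (hz₁ : col (loc z₁) = (a, b)) (hz₂ : col (loc z₂) = (b, a))
    (ha : a + b ∉ IwasawaAlgebra.augIdealP 2) (hb : a - b ∉ IwasawaAlgebra.augIdealP 2)
    (hY : lengthAt (IwasawaAlgebra 2) Y'
      ⟨IwasawaAlgebra.augIdealP 2, IwasawaAlgebra.isPrime_augIdealP_holds 2⟩ = 0)
    (f : X' →ₗ[IwasawaAlgebra 2] D.X) (hf : Finite (D.X ⧸ LinearMap.range f)) : D.mu = 0 := by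
  let 𝔭 : PrimeSpectrum (IwasawaAlgebra 2) :=
    ⟨IwasawaAlgebra.augIdealP 2, IwasawaAlgebra.isPrime_augIdealP_holds 2⟩
  have hX' : lengthAt (IwasawaAlgebra 2) X' 𝔭 = 0 :=
    lengthAt_augIdealP_eq_zero_of_twoBranchSkeleton 2 loc toX π col hcol h0 hX hz₁ hz₂ ha hb 𝔭 rfl hY
  have hc : lengthAt (IwasawaAlgebra 2) (D.X ⧸ LinearMap.range f) 𝔭 = 0 :=
    lengthAt_augIdealP_eq_zero_of_finite 2 _ 𝔭 rfl
  have hX0 : lengthAt (IwasawaAlgebra 2) D.X 𝔭 = 0 :=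
    le_antisymm ((lengthAt_le_of_lengthAt_coker_eq_zero f 𝔭 hc).trans hX'.le) bot_le
  change muInvariant 2 D.X = 0
  rw [muInvariant_eq_toNat_lengthAt 2 D.X 𝔭 rfl, hX0]
  rfl

end AtTwoOverQi

end Summit.BirchSwinnertonDyer.BirchSwinnertonDyer.Theorems.AlignedTransportAtTwoFineRoad

end
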